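import Summits.CriticalPhenomena.PercolationContinuityZ3.Theorems.FK.Transplant.KNFreeSlabSupplier
import Summits.CriticalPhenomena.PercolationContinuityZ3.Theorems.FK.Transplant.KNFreeElongatedRelative
import Summits.CriticalPhenomena.PercolationContinuityZ3.Theorems.FK.Transplant.KNFreeTargetStepIVSupplier
import Summits.CriticalPhenomena.PercolationContinuityZ3.Theorems.FK.Transplant.UFSC0TargetMatrices
import Summits.CriticalPhenomena.PercolationContinuityZ3.Theorems.FK.Transplant.FHSlabPercolation
import HarnessLib

/-!
# FRONTIER TRANSPLANT, binder 2 (TP_FK) — T4-SLAB (P6): the record's CONCLUSION `∃ r, UFSC0 d q p r ε₀` for every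
# `q ≥ 1`, `d ≥ 3`, `0 < p < 1` ABOVE THE SLAB THRESHOLD (`Π(p, L)` for some `L`, e.g. `p̂_c(q) < p`); and for `q = 2`
# on the whole supercritical phase GIVEN Bodineau's theorem `p̂_c(2) = p_c(2)` (displayed named fact, FBN-01)

Support file (`--supports stmt-CriticalPhenomena-4575`, helper) of the FRONTIER TRANSPLANT sub-cell (`fk-continuity/transplant/`,
seat `prim-bschramm-fkt-p1`); builds on p205010 (kernel theorem, internal audit signed; external expert review pending).
0 definitions · 0 named facts · 0 sorries · standard axioms. File 18/18 of the bytes-first package (R60 (3)(β)) of the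
UNFUNDED memo row `T4-SLAB [g122, R60]` (re-described R62 (E)); proposable only on a coordinator ruling.
Registered R63 (cell INBOX l.4709, 2026-08-23); registry row T4s; lead label T4s-18 (fkt-lead L22, l.4677).

HONEST FRAMING (page 1, cell rule). WITNESS of the record's CONCLUSION above the slab threshold `p̂_c(q) ≥ p_c(q)` (equality
= GRC Conj. (5.103), open for `q ∉ {1, 2}`; for `q = 2` it is Bodineau's theorem, displayed, not in the tree): binder 2
(`KNFreeTargetHittable d q p`, ALL FK-hittable `H`) is BYPASSED for the record's target families (quarter faces, elongated
faces — centred box geometries, `IsBoxGeom`), NOT proved; binder 1 (FH) above the slab threshold is T1s-B's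
`fh_of_fkSlabPercolation` (p344865), used BY NAME; NOT a binder discharge, NOT `_r4`; nothing at `p ↓ p_c(q)` (K1/C5);
CONDITIONAL record `_r3` « 2 / 0 ☑ », n_open = 2, BINDER-OWNERS, FO-19 NO-GO unchanged. The transplant's theorem of record
`ufsc0_of_freeBoundaryHypothesis_r3` (p248245) is CONDITIONAL on FH AND on TP_FK, both OPEN at the same `p` for `q > 1`
(⇔ GRC Conj. (5.103) via K1; barrier note `Literature.Barriers.CriticalPhenomena.SamePFreeBoundaryCriteria`, FBN-01, cited
first); the transplant is a typed reduction, not a proof of FK continuity.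

* `fkTargetAt_of_fkSlabPercolation` — Kozma–Nitzan's target Lemma 10 for `fkLaw`, `q ≥ 1`, above the slab threshold, for
  families of centred box geometries: T2s's `fkTargetAt_of_fkStepIV_class` ∘ the slab supplier
  `fkStepIVAt_isBoxGeom_of_fkSlabPercolation` (`δ(ε)` independent of the family).
* `isHittableFK_of_mem_elongList_of_fkSlabPercolation`, `isHittableFK_elongGeom_of_fkSlabPercolation` — the elongated
  geometries (aspect `K ≥ 2`) are FK-hittable above the slab threshold: the relative Lemma 11 of `KNFreeElongatedRelative`
  fed by the quarter-face matrix and by `fh_of_fkSlabPercolation`.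
* `ufsc0_of_fkSlabPercolation` — `3 ≤ d`, `1 ≤ q`, `0 < ε₀`, `0 < p < 1`, `Π(p, L)` ⟹ `∃ r, UFSC0 d q p r ε₀`:
  T2s's `ufsc0_of_targetMatrices` on the two target matrices above + the aspect-6 hittability.
* `ufsc0_of_exists_fkSlabPercolation`, `ufsc0_of_fkSlabCriticalProb_lt` (`p̂_c(q) < p`), `ufsc0_two_of_rcCriticalProb_lt`
  (`q = 2`, `p_c(2) < p < 1`, GIVEN `Bodineau2005_slabThreshold`).

References: G. Kozma, S. Nitzan, arXiv:2401.12397 (2024), §4 Lemma 10, Lemma 11, Theorem 6 [KozmaNitzan2024]; G. Grimmett,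
*The Random-Cluster Model*, Springer 2006, §5.7 eq. (5.102), Conj. (5.103) [Grimmett2006]; T. Bodineau, PTRF 2005, Thm. 2.1
[Bodineau2005]; F. Severo, arXiv:2112.07490, Thm. 1.1 [Severo2024].
-/

noncomputable section

open MeasureTheory
open scoped ENNReal Classical

namespace Summit.CriticalPhenomena.PercolationContinuityZ3.Theorems.FK

open Literature.Probability.Percolation Literature.Probability.LatticeModels
open Literature.Probability.Percolation.GadgetSystem Literature.Probability.Percolation.KozmaNitzan
open Literature.Barriers.CriticalPhenomena

variable {d : ℕ}

/-- **Kozma–Nitzan's target Lemma 10 for `fkLaw`, `q ≥ 1`, from the slab property `Π(p, L)`, for centred box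
geometries** (the record's RELATIVE binder 2 above the slab threshold). For `d ≥ 3`, `0 < p < 1` with
`FKSlabPercolation d p q L`: every `ε > 0` has `δ > 0` such that every finite family `H` of centred box geometries admits
`R` with `FKTargetAt d q p δ ε H R`. Proof: T2s's `fkTargetAt_of_fkStepIV_class` (KN pp. 17–22 for `fkLaw` from any
Step-IV supplier) applied to the slab supplier `fkStepIVAt_isBoxGeom_of_fkSlabPercolation`.
[cite: KozmaNitzan2024, §4 Lemma 10 (pp. 17–22); Grimmett2006, §5.7 eq. (5.102), Thm. (3.7), Thm. (3.8), eq. (3.22)] -/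
theorem fkTargetAt_of_fkSlabPercolation (hd : 3 ≤ d) {q : ℝ} (hq : 1 ≤ q) (p : unitInterval)
    (hp0 : 0 < (p : ℝ)) (hp1 : (p : ℝ) < 1) {L : ℕ} (hSP : FKSlabPercolation d (p : ℝ) q L)
    {ε : ℝ} (hε : 0 < ε) :
    ∃ δ : ℝ, 0 < δ ∧ ∀ H : List (Geom d), (∀ g ∈ H, IsBoxGeom g) → ∃ R : ℕ, FKTargetAt d q p δ ε H R := by
  haveI : NeZero d := ⟨by omega⟩
  exact fkTargetAt_of_fkStepIV_class hq p hp0 hp1 IsBoxGeom (fkStepIVAt_isBoxGeom_of_fkSlabPercolation hd hq p hp0 hSP) hε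

/-- **`Π(p, L) ⇒` the elongated geometries are FK-hittable** (`d ≥ 3`, `q ≥ 1`, `0 < p < 1`, `K ≥ 2`): the relative
Lemma 11 (`isHittableFK_of_mem_elongList_of_qfTarget`) fed by the quarter-face matrix of `fkTargetAt_of_fkSlabPercolation`
and by T1s-B's `FH` (`fh_of_fkSlabPercolation`). [cite: KozmaNitzan2024, §4 Lemma 11 (pp. 22–23); Grimmett2006, §5.7 eq. (5.102)] -/
theorem isHittableFK_of_mem_elongList_of_fkSlabPercolation (hd : 3 ≤ d) {q : ℝ} (hq : 1 ≤ q) (p : unitInterval)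
    (hp : (p : ℝ) ∈ Set.Ioo 0 1) {L : ℕ} (hSP : FKSlabPercolation d (p : ℝ) q L)
    (K : ℕ) (hK : 2 ≤ K) : ∀ g ∈ elongList d K (by omega), IsHittableFK q p g := by
  haveI : NeZero d := ⟨by omega⟩
  refine isHittableFK_of_mem_elongList_of_qfTarget hq p (fun ε hε => ?_) (fh_of_fkSlabPercolation hd hq hSP) K hK
  obtain ⟨δ, hδ, hH⟩ := fkTargetAt_of_fkSlabPercolation hd hq p hp.1 hp.2 hSP hε
  obtain ⟨R, hR⟩ := hH (qfList d) fun g hg => isBoxGeom_of_mem_qfList hg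
  exact ⟨δ, hδ, R, hR⟩

/-- **`Π(p, L) ⇒` each elongated geometry `(a, σ, K)` of aspect `K ≥ 2` is FK-hittable** (`d ≥ 3`, `q ≥ 1`, `0 < p < 1`;
the name reserved by R60 (2)). [cite: KozmaNitzan2024, §4 Lemma 11 (pp. 22–23); Grimmett2006, §5.7 eq. (5.102)] -/
theorem isHittableFK_elongGeom_of_fkSlabPercolation (hd : 3 ≤ d) {q : ℝ} (hq : 1 ≤ q) (p : unitInterval)
    (hp : (p : ℝ) ∈ Set.Ioo 0 1) {L : ℕ} (hSP : FKSlabPercolation d (p : ℝ) q L)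
    (a : Fin d) (σ : ℤˣ) (K : ℕ) (hK : 2 ≤ K) : IsHittableFK q p (elongGeom a σ K (by omega)) :=
  isHittableFK_of_mem_elongList_of_fkSlabPercolation hd hq p hp hSP K hK _ (elongGeom_mem_elongList _ _ _ _)

/-- **T4-SLAB — `UFSC0` above the slab threshold.** For `3 ≤ d`, `1 ≤ q`, `0 < ε₀`, `0 < p < 1` and `Π(p, L)`
(`FKSlabPercolation d p q L`, any `L`): `∃ r, UFSC0 d q p r ε₀`. Proof: T2s's matrix-level assembly
`ufsc0_of_targetMatrices` (KN Theorem 6's constants: Lemma 12-FK from the two matrices, rows 5/6, one free look) on the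
quarter-face and elongated target matrices of `fkTargetAt_of_fkSlabPercolation` (`δ` uniform in the aspect) and the
aspect-6 FK-hittability above. WITNESS of the record's CONCLUSION for every `q ≥ 1` above `p̂_c(q)`; NOT a discharge of
FH or TP_FK; nothing at `p ↓ p_c(q)`. [cite: KozmaNitzan2024, §4 Theorem 6 (pp. 25–26); Grimmett2006, §5.7 eq. (5.102), Conj. (5.103)] -/
theorem ufsc0_of_fkSlabPercolation (hd : 3 ≤ d) {q : ℝ} {ε₀ : ℝ} (hq : 1 ≤ q) (hε₀ : 0 < ε₀)
    (p : unitInterval) (hp : (p : ℝ) ∈ Set.Ioo 0 1) {L : ℕ} (hSP : FKSlabPercolation d (p : ℝ) q L) :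
    ∃ r : ℕ, UFSC0 d q p r ε₀ := by
  haveI : NeZero d := ⟨by omega⟩
  refine ufsc0_of_targetMatrices hd hq hε₀ p (fun ε hε => ?_) (fun ε hε => ?_)
    (isHittableFK_of_mem_elongList_of_fkSlabPercolation hd hq p hp hSP 6 (by norm_num))
  · obtain ⟨δ, hδ, hH⟩ := fkTargetAt_of_fkSlabPercolation hd hq p hp.1 hp.2 hSP hε
    obtain ⟨R₀, hR₀⟩ := hH (qfList d) fun g hg => isBoxGeom_of_mem_qfList hg
    exact ⟨δ, hδ, R₀, hR₀⟩
  · obtain ⟨δ, hδ, hH⟩ := fkTargetAt_of_fkSlabPercolation hd hq p hp.1 hp.2 hSP hε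
    refine ⟨δ, hδ, fun K hK => ?_⟩
    obtain ⟨R₀, hR₀⟩ := hH (elongList d K (by omega)) fun g hg => isBoxGeom_of_mem_elongList (K := K) (by omega) hg
    exact ⟨R₀, hR₀⟩

/-- **`UFSC0` above the slab critical point**: `3 ≤ d`, `1 ≤ q`, `0 < ε₀`, `0 < p < 1`, and `Π(p, L)` for SOME `L`
(e.g. `p̂_c(q) < p`) give `∃ r, UFSC0 d q p r ε₀`. [cite: Grimmett2006, §5.7 eq. (5.102); KozmaNitzan2024, §4 Theorem 6] -/
theorem ufsc0_of_exists_fkSlabPercolation (hd : 3 ≤ d) {q : ℝ} {ε₀ : ℝ} (hq : 1 ≤ q) (hε₀ : 0 < ε₀)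
    (p : unitInterval) (hp : (p : ℝ) ∈ Set.Ioo 0 1) (hSP : ∃ L, FKSlabPercolation d (p : ℝ) q L) :
    ∃ r : ℕ, UFSC0 d q p r ε₀ := by
  obtain ⟨L, hSP⟩ := hSP
  exact ufsc0_of_fkSlabPercolation hd hq hε₀ p hp hSP

/-- **`UFSC0` above the slab threshold `p̂_c(q)`** (`d ≥ 3`, `q ≥ 1`, `ε₀ > 0`, `0 < p < 1`, `p̂_c(q) < p`): some
`p' < p` has `Π(p', L)`, `Π` is monotone in `p`, and `ufsc0_of_fkSlabPercolation` applies. For `q ∉ {1, 2}` the gap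
`[p_c(q), p̂_c(q)]` is Conjecture (5.103). [cite: Grimmett2006, §5.7 eq. (5.102), Conj. (5.103); KozmaNitzan2024, §4 Theorem 6] -/
theorem ufsc0_of_fkSlabCriticalProb_lt (hd : 3 ≤ d) {q : ℝ} {ε₀ : ℝ} (hq : 1 ≤ q) (hε₀ : 0 < ε₀)
    (p : unitInterval) (hp : (p : ℝ) ∈ Set.Ioo 0 1) (h : fkSlabCriticalProb d q < (p : ℝ)) :
    ∃ r : ℕ, UFSC0 d q p r ε₀ := by
  have hq0 : 0 < q := one_pos.trans_le hq
  obtain ⟨p', ⟨hp', L, hL⟩, hp'p⟩ := exists_lt_of_csInf_lt ⟨1, one_mem_fkSlabCriticalSet hq0⟩ h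
  exact ufsc0_of_fkSlabPercolation hd hq hε₀ p hp (hL.mono hp' p.2 hp'p.le hq)

/-- **`q = 2`, `d ≥ 3`: `UFSC0` on the whole supercritical phase of 3D FK-Ising, GIVEN Bodineau's theorem** (the
displayed named fact `Bodineau2005_slabThreshold`: `p̂_c(2) = p_c(2)`; FBN-01): for every `p > p_c(2)` with `p < 1` and
every `ε₀ > 0`, `∃ r, UFSC0 d 2 p r ε₀`. The record's CONCLUSION for `q = 2` modulo ONE published theorem (today the tree
had it only in the Bernoulli window `p > 2p_c(ℤ³)/(1+p_c(ℤ³))`, T3w); binder 2 `KNFreeTargetHittable d 2 p` itself stays OPEN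
(K1/C5: nothing at `p ↓ p_c(2)`). CONDITIONAL on the named fact only.
[cite: Bodineau2005, Thm. 2.1; Severo2024, Thm. 1.1; KozmaNitzan2024, §4 Theorem 6; Grimmett2006, Conj. (5.103)] -/
theorem ufsc0_two_of_rcCriticalProb_lt (hB : Bodineau2005_slabThreshold) (hd : 3 ≤ d) {ε₀ : ℝ} (hε₀ : 0 < ε₀)
    (p : unitInterval) (hp : (p : ℝ) ∈ Set.Ioo 0 1) (hlt : rcCriticalProb d 2 < (p : ℝ)) :
    ∃ r : ℕ, UFSC0 d 2 p r ε₀ := by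
  obtain ⟨L, hL⟩ := hB.fkSlabPercolation hd p.2 hlt
  exact ufsc0_of_fkSlabPercolation hd (by norm_num) hε₀ p hp hL

end Summit.CriticalPhenomena.PercolationContinuityZ3.Theorems.FK

end
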